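import Literature.Analysis.InnerProduct.SecularExcessMulti
import Summits.RiemannHypothesis.RiemannHypothesis.Theorems.PfPersistenceIntruderShadowMulti
import HarnessLib

/-!
# PF-persistence THEORY 3 (gen 6, part 2) — the MULTI-DRIVER ARRIVAL LAW read on a split
# `T = B − ∑ᵢ |vᵢ⟩⟨vᵢ|` (publication cell `pub-rhpf`, theory seat 3)

Framing (page 1 of every `pub-rhpf` file): **mechanism/rigidity campaign — nothing here is a claim
about RH.** Everything in this file is PROVED abstract linear algebra; no statement about `ζ` or
about any control family is made; every empirical sentence in the docstrings is labelled DATA and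
refers to `run/shared/lean/pub/pub-rhpf/pub-rhpf-theory-3/THEORY-INTRUDER.md` §11.

Setting (continuing `PfPersistenceIntruderShadowMulti` and `PfPersistenceIntruderArrival`): `E` a real
inner product space (the even cosine sector of a windowed form), `T : E →ₗ[ℝ] E` the window's Galerkin
operator, `S : OffLineSplitN T ι` a split `T = B − ∑ᵢ |vᵢ⟩⟨vᵢ|` with `B ≥ 0` (`vᵢ = 2dᵢ`, the
`dᵢ` the Im-profiles of the `m = #ι` listed off-line zero quadruples), `I : Intruder T` a unit
eigenvector `u` with eigenvalue `I.eig = −|ε| < 0`, `z : ι → E` witnesses `B zᵢ = vᵢ` (`zᵢ = B⁻¹vᵢ`),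
`cᵢ := ⟪vᵢ, u⟫` the MOMENT VECTOR of the intruder, `M = (⟪vᵢ, zⱼ⟫) = VᵀB⁻¹V` the capacitance matrix
(gen 4: `n₋(T) = #{eigenvalues of M above 1}`), `Ex(c) = cᵀ(M − I)c` its EXCESS form, and
`Z c := ∑ⱼ cⱼ zⱼ = B⁻¹V c` the combined witness. The tree file
`Literature/Analysis/InnerProduct/SecularExcessMulti.lean` gives, read on the split:

* `moment_row_eq`      — `M c = c + |ε| Zᵀu` row by row (`∑ᵢ cᵢ⟪vᵢ,zⱼ⟫ = cⱼ + |ε|⟪u,zⱼ⟫`);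
* `excess_eq`          — the EXCESS IDENTITY `Ex(c) = |ε| ⟪u, Z c⟫`;
* `negEig_le_excess` / `excess_le_negEig_mul_sq` — the TWO-SIDED ARRIVAL LAW
  `|ε| ≤ Ex(c) ≤ |ε| ‖Z c‖²` (`‖u‖ = 1`), i.e. `Ex(c)/‖B⁻¹Vc‖² ≤ |ε| ≤ Ex(c)`;
* `sum_sq_moment_eq`   — `|c|² = ⟪B u, u⟫ + |ε|`;
* `negEig_le_of_capacitance_le` — `λ_max(M) ≤ μ ⇒ |ε| ≤ (μ − 1)|c|² = (μ − 1)(⟪B u,u⟫ + |ε|)`;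
* `excess_nonneg_of_eigenpair` — `Ex ≥ 0` at the moment vector of EVERY eigenpair of the window with
  eigenvalue `≤ 0` (not only the intruders packaged as `Intruder`).

Reading (PROVED): with several drivers on, EACH negative eigenvalue of the window is the capacitance
excess at its own moment vector over a squared length between `1` and `‖B⁻¹Vc‖²` — the `m`-driver
form of gen 6's arrival law (`m = 1`: `s − 1 = |ε|⟨y, z⟩`, file `PfPersistenceIntruderArrival`); the
second, third, … negative eigenvalues are born continuously where the second, third, … eigenvalue of
`M(a)` crosses `1` (THEORY-INTRUDER §10: DH second driver on between `a = 1.85` and `1.90`, Epstein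
between `1.75` and `1.80`; DATA). Same positivity premise `B ≥ 0` as gens 4–5, re-typed by
`PfPersistenceIntruderArrival.partialRemainder_nonneg_iff` (the unlisted drivers are jointly
sub-critical) and absent for a complete split.

Don't-look sentence (RULING A24 k4): every statement here holds for ANY symmetric window admitting
such a split; nothing in this file separates `ζ` from a control, and `ι = ∅` for `ζ` would be the
RH-shaped statement the cell does not make.

## References
* P. Arbenz, G. H. Golub, SIAM J. Matrix Anal. Appl. 9 (1988) 40–58 (block secular equation). [ArbenzGolub1988]
* G. H. Golub, C. F. Van Loan, *Matrix Computations*, 4th ed. (2013), Thm 8.4.3. [GolubVanLoan2013]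
* E. V. Haynsworth, Linear Algebra Appl. 1 (1968) 73–81. [Haynsworth1968]
-/

noncomputable section

open scoped InnerProductSpace BigOperators

set_option linter.dupNamespace false

namespace Summit.RiemannHypothesis.RiemannHypothesis.Theorems.PfPersistenceIntruderArrivalMulti

open Literature.Analysis.InnerProduct
open Summit.RiemannHypothesis.RiemannHypothesis.Theorems.PfPersistenceIntruderOrthogonality (Intruder)
open Summit.RiemannHypothesis.RiemannHypothesis.Theorems.PfPersistenceIntruderShadowMulti (OffLineSplitN)

variable {E : Type*} [NormedAddCommGroup E] [InnerProductSpace ℝ E]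
variable {ι : Type*} [Fintype ι] {T : E →ₗ[ℝ] E} (S : OffLineSplitN T ι)

/-- A unit eigenvector has `⟪u, u⟫ = 1`. [folklore] -/
theorem inner_vec_self (I : Intruder T) : ⟪I.vec, I.vec⟫_ℝ = 1 := by
  rw [real_inner_self_eq_norm_sq, I.norm_eq]; norm_num

/-- Row `j` of the moment system of an intruder: `∑ᵢ ⟪vᵢ,u⟫⟪vᵢ,zⱼ⟫ = ⟪vⱼ,u⟫ + |ε| ⟪u,zⱼ⟫`
(`M c = c + |ε| Zᵀu`; tree `finiteRank_downdate_moment_row_eq`). [folklore] -/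
theorem moment_row_eq (I : Intruder T) (z : ι → E) (hz : ∀ i, S.B (z i) = S.v i) (j : ι) :
    ∑ i, ⟪S.v i, I.vec⟫_ℝ * ⟪S.v i, z j⟫_ℝ = ⟪S.v j, I.vec⟫_ℝ + (-I.eig) * ⟪I.vec, z j⟫_ℝ :=
  finiteRank_downdate_moment_row_eq S.B S.B_symm (S.intruder_eq I) hz j

/-- **Excess identity (multi-driver arrival law, exact form)**: for an intruder `u` with eigenvalue
`−|ε|` and witnesses `B zⱼ = vⱼ`, the capacitance excess at the moment vector is
`∑ᵢ∑ⱼ cᵢcⱼ⟪vᵢ,zⱼ⟫ − ∑ᵢ cᵢ² = |ε| ⟪u, ∑ⱼ cⱼ zⱼ⟫` (`cᵢ = ⟪vᵢ,u⟫`; tree `finiteRank_downdate_excess_eq`).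
[cite: ArbenzGolub1988, block secular equation] -/
theorem excess_eq (I : Intruder T) (z : ι → E) (hz : ∀ i, S.B (z i) = S.v i) :
    ∑ i, ∑ j, ⟪S.v i, I.vec⟫_ℝ * ⟪S.v j, I.vec⟫_ℝ * ⟪S.v i, z j⟫_ℝ - ∑ i, ⟪S.v i, I.vec⟫_ℝ ^ 2
      = (-I.eig) * ⟪I.vec, ∑ j, ⟪S.v j, I.vec⟫_ℝ • z j⟫_ℝ :=
  finiteRank_downdate_excess_eq S.B S.B_symm (S.intruder_eq I) hz

/-- **Arrival law, upper form**: `|ε| ≤ cᵀ(M − I)c` — the size of a negative eigenvalue is at most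
the capacitance excess at its own moment vector (`‖u‖ = 1`; tree
`finiteRank_downdate_excess_two_sided`). [cite: ArbenzGolub1988, block secular equation] -/
theorem negEig_le_excess (I : Intruder T) (z : ι → E) (hz : ∀ i, S.B (z i) = S.v i) :
    -I.eig ≤ ∑ i, ∑ j, ⟪S.v i, I.vec⟫_ℝ * ⟪S.v j, I.vec⟫_ℝ * ⟪S.v i, z j⟫_ℝ
      - ∑ i, ⟪S.v i, I.vec⟫_ℝ ^ 2 := by
  have h := (finiteRank_downdate_excess_two_sided S.B S.B_symm S.B_nonneg (neg_pos.mpr I.eig_neg)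
    (S.intruder_eq I) hz).1
  rwa [inner_vec_self, mul_one] at h

/-- **Arrival law, lower form**: `cᵀ(M − I)c ≤ |ε| ‖∑ⱼ cⱼ zⱼ‖²`, i.e. `|ε| ≥ Ex(c)/‖B⁻¹Vc‖²`
(tree `finiteRank_downdate_excess_two_sided`). [cite: ArbenzGolub1988, block secular equation] -/
theorem excess_le_negEig_mul_sq (I : Intruder T) (z : ι → E) (hz : ∀ i, S.B (z i) = S.v i) :
    ∑ i, ∑ j, ⟪S.v i, I.vec⟫_ℝ * ⟪S.v j, I.vec⟫_ℝ * ⟪S.v i, z j⟫_ℝ - ∑ i, ⟪S.v i, I.vec⟫_ℝ ^ 2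
      ≤ (-I.eig) * ⟪∑ j, ⟪S.v j, I.vec⟫_ℝ • z j, ∑ j, ⟪S.v j, I.vec⟫_ℝ • z j⟫_ℝ :=
  (finiteRank_downdate_excess_two_sided S.B S.B_symm S.B_nonneg (neg_pos.mpr I.eig_neg)
    (S.intruder_eq I) hz).2

/-- The squared moment vector of an intruder is the remainder's Rayleigh quotient plus `|ε|`:
`∑ᵢ ⟪vᵢ,u⟫² = ⟪B u, u⟫ + |ε|` (tree `finiteRank_downdate_sum_sq_moment_eq`). [folklore] -/
theorem sum_sq_moment_eq (I : Intruder T) :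
    ∑ i, ⟪S.v i, I.vec⟫_ℝ ^ 2 = ⟪S.B I.vec, I.vec⟫_ℝ + (-I.eig) := by
  have h := finiteRank_downdate_sum_sq_moment_eq S.B (S.intruder_eq I)
  rwa [inner_vec_self, mul_one] at h

/-- **Eigenvalue bound by the top of the capacitance spectrum**: if `cᵀMc ≤ μ|c|²` for all `c`
(`λ_max(VᵀB⁻¹V) ≤ μ`) then `|ε| ≤ (μ − 1) ∑ᵢ ⟪vᵢ,u⟫²` for every intruder (tree
`finiteRank_downdate_eig_mul_inner_self_le`); with `sum_sq_moment_eq`, `|ε| ≤ (μ − 1)(⟪B u,u⟫ + |ε|)`.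
[cite: ArbenzGolub1988, block secular equation] -/
theorem negEig_le_of_capacitance_le (I : Intruder T) (z : ι → E) (hz : ∀ i, S.B (z i) = S.v i)
    {μ : ℝ} (hμ : ∀ c : ι → ℝ, ∑ i, ∑ j, c i * c j * ⟪S.v i, z j⟫_ℝ ≤ μ * ∑ i, c i ^ 2) :
    -I.eig ≤ (μ - 1) * ∑ i, ⟪S.v i, I.vec⟫_ℝ ^ 2 := by
  have h := finiteRank_downdate_eig_mul_inner_self_le S.B S.B_symm S.B_nonneg
    (neg_pos.mpr I.eig_neg) (S.intruder_eq I) hz hμ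
  rwa [inner_vec_self, mul_one] at h

/-- The excess form is nonnegative at the moment vector of EVERY eigenpair `T u = −ε u` with `ε ≥ 0`
(not only unit intruders): `0 ≤ ∑ᵢ∑ⱼ ⟪vᵢ,u⟫⟪vⱼ,u⟫⟪vᵢ,zⱼ⟫ − ∑ᵢ ⟪vᵢ,u⟫²`
(tree `finiteRank_downdate_excess_nonneg`). [folklore] -/
theorem excess_nonneg_of_eigenpair {u : E} {ε : ℝ} (hε : 0 ≤ ε) (hu : T u = -(ε • u))
    (z : ι → E) (hz : ∀ i, S.B (z i) = S.v i) :
    0 ≤ ∑ i, ∑ j, ⟪S.v i, u⟫_ℝ * ⟪S.v j, u⟫_ℝ * ⟪S.v i, z j⟫_ℝ - ∑ i, ⟪S.v i, u⟫_ℝ ^ 2 := by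
  have hu' : S.B u - ∑ i, ⟪S.v i, u⟫_ℝ • S.v i = -(ε • u) := by rw [← S.apply_eq, hu]
  exact finiteRank_downdate_excess_nonneg S.B S.B_symm S.B_nonneg hε hu' hz

end Summit.RiemannHypothesis.RiemannHypothesis.Theorems.PfPersistenceIntruderArrivalMulti
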